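import Summits.ABC.StewartYu.PadicW80ParLPM
import Summits.ABC.StewartYu.PadicW80SizesLC
import HarnessLib

/-!
# The archimedean sizes at the `(log p)`-normalised record — SHARP forms in the fine unit `𝔔 = exp(𝔘/1024)`
# (provider B of the twist, `p ≡ 1 (mod 4)`: half step with Liouville exponent `2^{d+2}`)

Support file (theorems only; no named fact), cell `abc-stewartyu` (seat p1; sequel to `PadicW80ParLPM.lean`,
interface for crux `W80OneModFour`, stmt-ABC-19487).  For a frame `S : CW77.Setup` at the record
`P : PadicW80ParL S.d` under the height link `hy : S.SizeHyp P.V P.Vθ P.W`, the landed size lemmas of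
`PadicW80SizesL{H,B,C}` are re-proved with their TRUE exponents in the fine unit `𝔔 = 𝔅^{1/16}`:
`|b_θ|^k ≤ 𝔔`, `|qA| ≤ 𝔔`, `|qΔ| ≤ 𝔔⁴`, `#box_J ≤ 𝔔` (all formerly `≤ 𝔅`), whence
`|D(s,τ)·qTerm| ≤ AmaxPM = 𝔔²¹E(2)` on the box of level `0` (Siegel), `⌈#box₀·AmaxPM⌉ ≤ PrVPM`,
`|rHalf| ≤ RHalfPM = 𝔔⁵E(2)`, `Dhalf ≤ DmaxHPM = 𝔔¹⁶E(2)` and `∑_{u ∈ box} P·|r(u)| ≤ MmaxHPM` at the half points.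
With `PadicW80ParLPM.bhalf_le_budget_pm` these feed the landed `halfstep_ineq_one/two` unchanged.
The proofs are those of the landed lemmas with `exp(𝔘/256) ↦ 𝔔`. Everything is [folklore] book-keeping on
[cite: Waldschmidt1980, §3.2 (p. 266), §3.3–3.4 (pp. 268–270)].
-/

noncomputable section

open Finset Real
open Literature.NumberTheory.Transcendental
open Literature.NumberTheory.Transcendental.Baker1975
open Literature.NumberTheory.Transcendental.Baker1975.Ch3
open Literature.NumberTheory.Transcendental.CW77

namespace Literature.NumberTheory.Transcendental.CW77

namespace Setup

open Summit.ABC.StewartYu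
open Summit.ABC.StewartYu.PadicW80Par (cLp' cTp cLp mRp)
open Summit.ABC.StewartYu.PadicW80ParL (mR_pos two_le_mR)

variable {S : Setup} {P : PadicW80ParL S.d}

/-! ### Record-free sharp sizes: the `Δ`-factors and the number of unknowns -/

/-- **`|qΔ| ≤ 𝔔⁴`** at the `p`-adic depth: the rational values of the `Δ`-factors at the points
`x = 2^{J₀ᵖ−J} s ≤ Xᵖ`, `τ₀ ≤ T` (`τ₀! ≤ T^T ≤ 𝔔`, `scale^{τ₀} ≤ 𝔔`, `2^{a+bh} ≤ 𝔔`, binomials `≤ 𝔔`).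
[cite: Waldschmidt1980, §3.4 (p. 269)] [cite: BakerTNT1975, Ch. 3 §2 Lemma 1] -/
theorem abs_qΔ_le_𝔔 (P : PadicW80ParL S.d) {J : ℕ} (hJ : J ≤ P.J₀ℓ) (u : Idx S.d P.hparℓ P.Lbℓ)
    {τ₀ s : ℕ} (hs : s ≤ 2 ^ (S.d + 1 + J) * P.S₀ℓ) (hτ : τ₀ ≤ P.Tℓ) :
    |(S.qΔ (h := P.hparℓ) P.J₀ℓ J u τ₀ s : ℝ)| ≤ P.𝔔ℓ ^ 4 := by
  set x := scale P.J₀ℓ J * s with hxdef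
  have hxX : (x : ℝ) ≤ P.Xptℓ := S.scale_mul_le_Xptℓ P hJ hs
  set a : ℕ := (u.1.1 : ℕ) with ha
  set b : ℕ := (u.1.2 : ℕ) with hb
  have hR1 := P.one_le_hpar
  have hspec := (hdNat_spec (b := b) (le_of_lt u.1.1.isLt) x τ₀).2
  have hνpos : (0 : ℝ) < ((nuBound x P.hparℓ) ^ τ₀ : ℕ) := by exact_mod_cast Nat.pow_pos (nuBound_pos _ _)
  have h1 : |(S.qΔ (h := P.hparℓ) P.J₀ℓ J u τ₀ s : ℝ)| ≤
      (τ₀.factorial : ℝ) * (scale P.J₀ℓ J : ℝ) ^ τ₀ *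
        (2 ^ (a + b * P.hparℓ) * ((x + a).choose a * (x + P.hparℓ).choose P.hparℓ ^ b : ℕ) : ℝ) := by
    unfold qΔ
    rw [← hxdef]
    push_cast
    rw [abs_of_nonneg (by positivity), div_le_iff₀ (by push_cast at hνpos; exact_mod_cast hνpos)]
    have hE : ((hdNat (b := b) (le_of_lt u.1.1.isLt) x τ₀ : ℕ) : ℝ) ≤
        ((2 ^ (a + b * P.hparℓ) * nuBound x P.hparℓ ^ τ₀ *
          ((x + a).choose a * (x + P.hparℓ).choose P.hparℓ ^ b) : ℕ) : ℝ) := by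
      exact_mod_cast hspec
    push_cast at hE ⊢
    have h0 : (0 : ℝ) ≤ (τ₀.factorial : ℝ) * (scale P.J₀ℓ J : ℝ) ^ τ₀ := by positivity
    calc (τ₀.factorial : ℝ) * (scale P.J₀ℓ J : ℝ) ^ τ₀ * (hdNat (b := b) (le_of_lt u.1.1.isLt) x τ₀ : ℝ)
        ≤ (τ₀.factorial : ℝ) * (scale P.J₀ℓ J : ℝ) ^ τ₀ *
          (2 ^ (a + b * P.hparℓ) * (nuBound x P.hparℓ : ℝ) ^ τ₀ *
            (((x + a).choose a : ℝ) * ((x + P.hparℓ).choose P.hparℓ : ℝ) ^ b)) :=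
          mul_le_mul_of_nonneg_left hE h0
      _ = (τ₀.factorial : ℝ) * (scale P.J₀ℓ J : ℝ) ^ τ₀ *
          (2 ^ (a + b * P.hparℓ) * (((x + a).choose a : ℝ) * ((x + P.hparℓ).choose P.hparℓ : ℝ) ^ b)) *
            (nuBound x P.hparℓ : ℝ) ^ τ₀ := by
          ring
  -- the four factors, each `≤ 𝔔`
  have hT1 : (1 : ℝ) ≤ P.Tℓ := by exact_mod_cast P.one_le_T
  have hf1 : (τ₀.factorial : ℝ) ≤ P.𝔔ℓ := by
    have h2 : (τ₀.factorial : ℝ) ≤ (τ₀ : ℝ) ^ τ₀ := by exact_mod_cast Nat.factorial_le_pow τ₀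
    have h3 : (τ₀ : ℝ) ^ τ₀ ≤ (P.Tℓ : ℝ) ^ τ₀ := pow_le_pow_left₀ (Nat.cast_nonneg _) (by exact_mod_cast hτ) _
    exact h2.trans (h3.trans (P.T_pow_le_𝔔 hτ))
  have hf2 : (scale P.J₀ℓ J : ℝ) ^ τ₀ ≤ P.𝔔ℓ := by
    have h2 : (scale P.J₀ℓ J : ℝ) ≤ P.Tℓ := by exact_mod_cast S.scale_le_T_pℓ P J
    exact (pow_le_pow_left₀ (Nat.cast_nonneg _) h2 _).trans (P.T_pow_le_𝔔 hτ)
  have hab : a + b * P.hparℓ ≤ P.hparℓ * P.Lbℓ := by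
    have ha' : a < P.hparℓ := u.1.1.isLt
    have hb' : b < P.Lbℓ := u.1.2.isLt
    calc a + b * P.hparℓ ≤ P.hparℓ + b * P.hparℓ := by omega
      _ = (b + 1) * P.hparℓ := by ring
      _ ≤ P.Lbℓ * P.hparℓ := Nat.mul_le_mul_right _ hb'
      _ = P.hparℓ * P.Lbℓ := Nat.mul_comm _ _
  have hf3 : (2 : ℝ) ^ (a + b * P.hparℓ) ≤ P.𝔔ℓ :=
    (pow_le_pow_right₀ (by norm_num) hab).trans P.two_pow_hLb_le_𝔔
  have hf4 : (((x + a).choose a * (x + P.hparℓ).choose P.hparℓ ^ b : ℕ) : ℝ) ≤ P.𝔔ℓ := by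
    have hC : ((x + a).choose a : ℝ) ≤ (x + P.hparℓ).choose P.hparℓ := by
      have : (x + a).choose a ≤ (x + P.hparℓ).choose P.hparℓ := by
        have e1 : (x + a).choose a = (x + a).choose x := (Nat.choose_symm_add (a := x) (b := a)).symm
        have e2 : (x + P.hparℓ).choose P.hparℓ = (x + P.hparℓ).choose x :=
          (Nat.choose_symm_add (a := x) (b := P.hparℓ)).symm
        rw [e1, e2]
        exact Nat.choose_le_choose x (by have := u.1.1.isLt; omega)
      exact_mod_cast this
    have hCe := choose_le_exp_mul_div_pow (x := x) hR1
    have hbase : 1 ≤ Real.exp 1 * ((x : ℝ) + P.hparℓ) / P.hparℓ := by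
      rw [le_div_iff₀ P.hpar_pos]
      have := Real.exp_one_gt_two; have := Nat.cast_nonneg (α := ℝ) x
      nlinarith
    push_cast
    calc ((x + a).choose a : ℝ) * ((x + P.hparℓ).choose P.hparℓ : ℝ) ^ b
        ≤ ((x + P.hparℓ).choose P.hparℓ : ℝ) ^ (b + 1) := by
          rw [pow_succ]; nlinarith [pow_nonneg (Nat.cast_nonneg (α := ℝ) ((x + P.hparℓ).choose P.hparℓ)) b]
      _ ≤ ((Real.exp 1 * (x + P.hparℓ) / P.hparℓ) ^ P.hparℓ) ^ (b + 1) := pow_le_pow_left₀ (Nat.cast_nonneg _) hCe _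
      _ = (Real.exp 1 * ((x : ℝ) + P.hparℓ) / P.hparℓ) ^ (P.hparℓ * (b + 1)) := by rw [← pow_mul]
      _ ≤ (Real.exp 1 * ((x : ℝ) + P.hparℓ) / P.hparℓ) ^ (P.hparℓ * P.Lbℓ) := by
          refine pow_le_pow_right₀ hbase (Nat.mul_le_mul_left _ ?_)
          exact u.1.2.isLt
      _ ≤ P.𝔔ℓ := P.ratio_pow_le_𝔔 hxX
  refine h1.trans ?_
  have hE := P.𝔔_pos
  calc (τ₀.factorial : ℝ) * (scale P.J₀ℓ J : ℝ) ^ τ₀ *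
        (2 ^ (a + b * P.hparℓ) * ((x + a).choose a * (x + P.hparℓ).choose P.hparℓ ^ b : ℕ) : ℝ)
      ≤ P.𝔔ℓ * P.𝔔ℓ * (P.𝔔ℓ * P.𝔔ℓ) := by
        refine mul_le_mul (mul_le_mul hf1 hf2 (by positivity) hE.le)
          (mul_le_mul hf3 hf4 (by positivity) hE.le) (by positivity) (by positivity)
    _ = P.𝔔ℓ ^ 4 := by ring

/-- **`#box_J ≤ 𝔔`** for the `p`-adic ranges: `#box_J ≤ h L_b ∏ (Lallᵖᵢ + 1) ≤ (2U)^{d+2}` and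
`(d+2)·log(2U) ≤ 22 m W⋆ ≤ 𝔘/1024`. [cite: Waldschmidt1980, §3.2 (p. 266)] -/
theorem card_box_le_𝔔 (P : PadicW80ParL S.d) (J : ℕ) :
    ((S.box (h := P.hparℓ) (Lb := P.Lbℓ) P.Lℓ P.Lθℓ J).card : ℝ) ≤ P.𝔔ℓ := by
  rw [S.card_box]
  push_cast
  have hU := P.U_pos
  have hU1 : (1 : ℝ) ≤ P.Uℓ := by
    have h2 := P.𝔘_ge'
    have h5 : P.𝔘ℓ ≤ P.Uℓ := by
      rw [P.U_eq]; have : (1 : ℝ) ≤ 2 ^ (S.d + 1) := one_le_pow₀ (by norm_num)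
      nlinarith [P.𝔘_pos]
    linarith [show (1 : ℝ) ≤ 2 ^ 98 by norm_num]
  have hY : ∀ i, ((P.Lallℓ i / 2 ^ J : ℕ) : ℝ) + 1 ≤ 2 * P.Uℓ := by
    intro i
    have h1 : ((P.Lallℓ i / 2 ^ J : ℕ) : ℝ) ≤ P.Lallℓ i := by exact_mod_cast Nat.div_le_self _ _
    have h2 := P.Lallp_le_U i
    linarith
  have hhLb : (P.hparℓ : ℝ) * P.Lbℓ ≤ 2 * P.Uℓ := by
    have h1 := P.hparLb_le; have h2 := P.Wstar_le_𝔘; have h3 := P.𝔘_pos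
    have h5 : P.𝔘ℓ ≤ P.Uℓ := by
      rw [P.U_eq]; have : (1:ℝ) ≤ 2 ^ (S.d + 1) := one_le_pow₀ (by norm_num)
      nlinarith
    have : P.𝔘ℓ / cLp + 4 * P.Wstarℓ ≤ 2 * P.𝔘ℓ := by unfold cLp; nlinarith
    linarith
  have hprod : (∏ j, (((P.Lℓ j / 2 ^ J : ℕ) : ℝ) + 1)) ≤ (2 * P.Uℓ) ^ S.d := by
    calc (∏ j, (((P.Lℓ j / 2 ^ J : ℕ) : ℝ) + 1)) ≤ ∏ _j : Fin S.d, (2 * P.Uℓ) :=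
          prod_le_prod (fun j _ => by positivity) fun j _ => by simpa using hY (Fin.castSucc j)
      _ = (2 * P.Uℓ) ^ S.d := by simp
  have hθ : (((P.Lθℓ / 2 ^ J : ℕ) : ℝ) + 1) ≤ 2 * P.Uℓ := by simpa using hY (Fin.last S.d)
  have htot : (P.hparℓ : ℝ) * P.Lbℓ * ((∏ j, (((P.Lℓ j / 2 ^ J : ℕ) : ℝ) + 1)) * (((P.Lθℓ / 2 ^ J : ℕ) : ℝ) + 1)) ≤
      (2 * P.Uℓ) ^ (S.d + 2) := by
    calc (P.hparℓ : ℝ) * P.Lbℓ * ((∏ j, (((P.Lℓ j / 2 ^ J : ℕ) : ℝ) + 1)) * (((P.Lθℓ / 2 ^ J : ℕ) : ℝ) + 1))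
        ≤ (2 * P.Uℓ) * ((2 * P.Uℓ) ^ S.d * (2 * P.Uℓ)) := by
          refine mul_le_mul hhLb (mul_le_mul hprod hθ (by positivity) (by positivity)) (by positivity) (by positivity)
      _ = (2 * P.Uℓ) ^ (S.d + 2) := by ring
  refine htot.trans (P.le_𝔔_of_log_le ?_)
  rw [Real.log_pow, Real.log_mul (by norm_num) hU.ne']
  have hlog := P.log_U_le
  have hl2 : Real.log 2 ≤ 1 := by linarith [Real.log_two_lt_d9]
  have hmW := P.mW_le_𝔘_p; have hW := P.one_le_Wstar; have h𝔘 := P.𝔘_pos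
  have hm : ((S.d + 2 : ℕ) : ℝ) ≤ 2 * mRp S.d := by
    have hd1 : (1 : ℝ) ≤ S.d := by exact_mod_cast P.hd
    unfold mRp; push_cast; linarith
  calc ((S.d + 2 : ℕ) : ℝ) * (Real.log 2 + Real.log P.Uℓ) ≤ (2 * mRp S.d) * (1 + 10 * P.Wstarℓ) := by
        refine mul_le_mul hm (by linarith) ?_ (by have := PadicW80ParL.mR_pos P; linarith)
        have : 0 ≤ Real.log P.Uℓ := Real.log_nonneg hU1
        have : 0 ≤ Real.log 2 := Real.log_nonneg one_le_two
        linarith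
    _ ≤ (2 * mRp S.d) * (11 * P.Wstarℓ) := by
        refine mul_le_mul_of_nonneg_left (by linarith) (by have := PadicW80ParL.mR_pos P; linarith)
    _ = 22 * (mRp S.d * P.Wstarℓ) := by ring
    _ ≤ P.𝔘ℓ / 1024 := by nlinarith

/-- **`⌈#box₀ · AmaxPM⌉ ≤ PrVPM`** (`#box₀ ≤ 𝔔`, `𝔔·AmaxPM + 1 ≤ PrVPM`): the integer coefficient bound of
Siegel's step on a class is below the sharp `PrVPM`. [folklore] -/
theorem ceil_card_box_mul_AmaxPM_le (P : PadicW80ParL S.d) :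
    ((⌈((S.box (h := P.hparℓ) (Lb := P.Lbℓ) P.Lℓ P.Lθℓ 0).card : ℝ) * P.AmaxPMℓ⌉ : ℤ) : ℝ) ≤ P.PrVPMℓ := by
  have hcard := S.card_box_le_𝔔 P 0
  have hA0 : 0 ≤ P.AmaxPMℓ := P.AmaxPM_pos.le
  have h1 : ((S.box (h := P.hparℓ) (Lb := P.Lbℓ) P.Lℓ P.Lθℓ 0).card : ℝ) * P.AmaxPMℓ ≤ P.𝔔ℓ * P.AmaxPMℓ :=
    mul_le_mul_of_nonneg_right hcard hA0
  have h2 := Int.ceil_lt_add_one (((S.box (h := P.hparℓ) (Lb := P.Lbℓ) P.Lℓ P.Lθℓ 0).card : ℝ) * P.AmaxPMℓ)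
  have h3 := P.𝔔_mul_AmaxPM_add_one_le
  linarith

/-- **`∑_{u ∈ box_J} P_int · |r(u)| ≤ MmaxHPM`** whenever `|r(u)| ≤ RHalfPM` on the box and `P_int ≤ PrVPM`
(`#box_J ≤ 𝔔`): the archimedean size of the class sums at a half point, over the WHOLE box. [folklore] -/
theorem sum_mul_abs_le_MmaxHPM (P : PadicW80ParL S.d) (J : ℕ) {r : Idx S.d P.hparℓ P.Lbℓ → ℝ}
    (hr : ∀ u ∈ S.box (h := P.hparℓ) (Lb := P.Lbℓ) P.Lℓ P.Lθℓ J, |r u| ≤ P.RHalfPMℓ)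
    {Pint : ℝ} (hP : Pint ≤ P.PrVPMℓ) :
    ∑ u ∈ S.box (h := P.hparℓ) (Lb := P.Lbℓ) P.Lℓ P.Lθℓ J, Pint * |r u| ≤ P.MmaxHPMℓ := by
  have hcard := S.card_box_le_𝔔 P J
  have hR0 : 0 ≤ P.RHalfPMℓ := P.RHalfPM_pos.le
  have hPr0 : 0 ≤ P.PrVPMℓ := P.PrVPM_pos.le
  calc ∑ u ∈ S.box (h := P.hparℓ) (Lb := P.Lbℓ) P.Lℓ P.Lθℓ J, Pint * |r u|
      ≤ ∑ u ∈ S.box (h := P.hparℓ) (Lb := P.Lbℓ) P.Lℓ P.Lθℓ J, P.PrVPMℓ * P.RHalfPMℓ :=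
        sum_le_sum fun u hu => mul_le_mul hP (hr u hu) (abs_nonneg _) hPr0
    _ = (S.box (h := P.hparℓ) (Lb := P.Lbℓ) P.Lℓ P.Lθℓ J).card * (P.PrVPMℓ * P.RHalfPMℓ) := by
        rw [sum_const, nsmul_eq_mul]
    _ ≤ P.𝔔ℓ * (P.PrVPMℓ * P.RHalfPMℓ) := mul_le_mul_of_nonneg_right hcard (mul_nonneg hPr0 hR0)
    _ = P.MmaxHPMℓ := by unfold PadicW80ParL.MmaxHPMℓ; ring

/-! ### The `SizeHyp` consequences in the fine unit -/

variable (hy : S.SizeHyp P.V P.Vθ P.W)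
include hy

/-- **`|b_θ|^k ≤ 𝔔`** for `k ≤ T` (`k W ≤ T W⋆ ≤ 𝔘/c_T`). [cite: Waldschmidt1980, §3.3 (p. 268)] -/
theorem SizeHyp.natAbs_bθ_pow_le_𝔔 {k : ℕ} (hk : k ≤ P.Tℓ) : ((S.bθ.natAbs ^ k : ℕ) : ℝ) ≤ P.𝔔ℓ := by
  refine (hy.natAbs_bθ_pow_le_exp k).trans (P.exp_le_𝔔 ?_)
  have hTW := P.TWstar_le; have hW := P.W_le_Wstar; have hT := P.T_pos; have hU := P.𝔘_pos
  have hW1 := P.hW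
  have hk' : (k : ℝ) ≤ P.Tℓ := by exact_mod_cast hk
  calc (k : ℝ) * P.W ≤ P.Tℓ * P.Wstarℓ := mul_le_mul hk' hW (by linarith) hT.le
    _ ≤ P.𝔘ℓ / cTp := hTW
    _ ≤ P.𝔘ℓ / 1024 := by unfold cTp; rw [div_le_div_iff₀ (by norm_num) (by norm_num)]; nlinarith

/-- **`|qA(u, τ')| ≤ 𝔔`** on the box of the `p`-adic ranges, `|τ'| ≤ T` (`T·log(2Ue^W) ≤ 12𝔘/c_T`).
[cite: Waldschmidt1980, §3.3 (proof of Lemma 3.3, p. 268)] -/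
theorem SizeHyp.abs_qA_le_𝔔 {J : ℕ} {u : Idx S.d P.hparℓ P.Lbℓ}
    (hu : u ∈ S.box (h := P.hparℓ) (Lb := P.Lbℓ) P.Lℓ P.Lθℓ J)
    {τ' : Fin S.d → ℕ} (hτ : ∑ j, τ' j ≤ P.Tℓ) : |(S.qA u τ' : ℝ)| ≤ P.𝔔ℓ := by
  set Γ := 2 * P.Uℓ * Real.exp P.W with hΓ
  have hΓ1 : 1 ≤ Γ := P.one_le_Γ_p
  have h1 : |(S.qA u τ' : ℝ)| ≤ Γ ^ P.Tℓ := by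
    unfold qA; push_cast
    rw [abs_prod]
    calc ∏ j, |(S.γ u j : ℝ) ^ τ' j| = ∏ j, |(S.γ u j : ℝ)| ^ τ' j := prod_congr rfl fun j _ => abs_pow _ _
      _ ≤ ∏ j, Γ ^ τ' j := prod_le_prod (fun j _ => by positivity)
          fun j _ => pow_le_pow_left₀ (abs_nonneg _) (hy.abs_γ_le_pℓ hu j) _
      _ = Γ ^ ∑ j, τ' j := (prod_pow_eq_pow_sum _ _ _)
      _ ≤ Γ ^ P.Tℓ := pow_le_pow_right₀ hΓ1 hτ
  refine h1.trans (P.le_𝔔_of_log_le ?_)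
  rw [Real.log_pow]
  have hT := P.T_pos; have hTW := P.TWstar_le; have hTU := P.T_le_𝔘; have hW := P.one_le_Wstar
  calc (P.Tℓ : ℝ) * Real.log Γ ≤ P.Tℓ * (11 * P.Wstarℓ + 1) := mul_le_mul_of_nonneg_left P.log_Γ_le_p hT.le
    _ = 11 * (P.Tℓ * P.Wstarℓ) + P.Tℓ := by ring
    _ ≤ 11 * (P.𝔘ℓ / cTp) + P.𝔘ℓ / cTp := by gcongr
    _ ≤ P.𝔘ℓ / 1024 := by unfold cTp; have := P.𝔘_pos; nlinarith

/-- **`|D(s,τ) · qTerm| ≤ AmaxPM = 𝔔²¹ E(2)`** on the box of level `0`, `s < S₀ᵖ`, `|τ| < T`: the sharp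
`Amax` of Siegel's step (`D ≤ 𝔔¹⁵·𝔔·E(1)`, `|qTerm| ≤ 𝔔⁴·𝔔·E(1)`). [cite: Waldschmidt1980, Lemma 3.2 (pp. 266–267)] -/
theorem SizeHyp.abs_Dclear_qTerm_le_pm {s : ℕ} (hs : s < P.S₀ℓ) {τ : Tau S.d} (hτ : tauNorm τ < P.Tℓ)
    {u : Idx S.d P.hparℓ P.Lbℓ} (hu : u ∈ S.box (h := P.hparℓ) (Lb := P.Lbℓ) P.Lℓ P.Lθℓ 0) :
    |((S.Dclear (h := P.hparℓ) P.J₀ℓ P.Lℓ P.Lθℓ s τ : ℕ) : ℝ) *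
        (S.qTerm (h := P.hparℓ) P.J₀ℓ 0 u τ s : ℝ)| ≤ P.AmaxPMℓ := by
  have hτ1 : τ.1 ≤ P.Tℓ := by unfold tauNorm at hτ; omega
  have hτ2 : ∑ j, τ.2 j ≤ P.Tℓ := by unfold tauNorm at hτ; omega
  have hs' : s ≤ 2 ^ (S.d + 1 + 0) * P.S₀ℓ := by
    have : P.S₀ℓ ≤ 2 ^ (S.d + 1 + 0) * P.S₀ℓ := Nat.le_mul_of_pos_left _ (Nat.pow_pos two_pos)
    omega
  have hs1 : s ≤ 2 ^ 0 * (1 * P.S₀ℓ) := by simp; omega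
  have hx : ((scale P.J₀ℓ 0 * s : ℕ) : ℝ) ≤ P.Xptℓ := S.scale_mul_le_Xptℓ P (Nat.zero_le _) hs'
  have h𝔔 := P.𝔔_pos
  -- the denominator `≤ 𝔔¹⁶ E₁`
  have hD : ((S.Dclear (h := P.hparℓ) P.J₀ℓ P.Lℓ P.Lθℓ s τ : ℕ) : ℝ) ≤
      P.𝔔ℓ ^ 16 * Real.exp (1 * (P.𝔘ℓ / (2 * cLp'))) := by
    unfold Dclear
    rw [Nat.cast_mul, Nat.cast_mul]
    have h1 : ((nuBound (scale P.J₀ℓ 0 * s) P.hparℓ ^ τ.1 : ℕ) : ℝ) ≤ P.𝔔ℓ ^ 15 := by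
      rw [Nat.cast_pow]; exact P.nuBound_pow_le_𝔔 hx hτ1
    have h2 : ((S.bθ.natAbs ^ (∑ j, τ.2 j) : ℕ) : ℝ) ≤ P.𝔔ℓ ^ 1 := by
      rw [pow_one]; exact hy.natAbs_bθ_pow_le_𝔔 hτ2
    have h3 : (((∏ j, (S.α j).den ^ (P.Lℓ j * s)) * S.θ.den ^ (P.Lθℓ * s) : ℕ) : ℝ) ≤
        Real.exp (1 * (P.𝔘ℓ / (2 * cLp'))) := by
      have key := hy.den_prod_le_pℓ (c := 1) (e := fun j => P.Lℓ j * s) (eθ := P.Lθℓ * s)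
        (fun j => by rw [one_mul]; exact Nat.mul_le_mul_left _ hs.le)
        (by rw [one_mul]; exact Nat.mul_le_mul_left _ hs.le)
      push_cast at key ⊢
      exact key
    have h12 := P.mul_le_𝔔_pow h1 h2 (Nat.cast_nonneg _)
    exact mul_le_mul h12 h3 (Nat.cast_nonneg _) (by positivity)
  -- the term `≤ 𝔔⁵ E₁`
  have hQ : |(S.qTerm (h := P.hparℓ) P.J₀ℓ 0 u τ s : ℝ)| ≤ P.𝔔ℓ ^ 5 * Real.exp (1 * (P.𝔘ℓ / (2 * cLp'))) := by
    unfold qTerm; push_cast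
    rw [abs_mul, abs_mul]
    have h1 : |(S.qΔ (h := P.hparℓ) P.J₀ℓ 0 u τ.1 s : ℝ)| ≤ P.𝔔ℓ ^ 4 := S.abs_qΔ_le_𝔔 P (Nat.zero_le _) u hs' hτ1
    have h2 : |(S.qA u τ.2 : ℝ)| ≤ P.𝔔ℓ ^ 1 := by rw [pow_one]; exact hy.abs_qA_le_𝔔 hu hτ2
    have h3 : |(S.qE u s : ℝ)| ≤ Real.exp ((1 : ℕ) * (P.𝔘ℓ / (2 * cLp'))) := hy.abs_qE_le_pℓ hu hs1
    rw [Nat.cast_one] at h3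
    have h12 := P.mul_le_𝔔_pow h1 h2 (abs_nonneg _)
    exact mul_le_mul h12 h3 (abs_nonneg _) (by positivity)
  rw [abs_mul, Nat.abs_cast]
  calc ((S.Dclear (h := P.hparℓ) P.J₀ℓ P.Lℓ P.Lθℓ s τ : ℕ) : ℝ) * |(S.qTerm (h := P.hparℓ) P.J₀ℓ 0 u τ s : ℝ)|
      ≤ (P.𝔔ℓ ^ 16 * Real.exp (1 * (P.𝔘ℓ / (2 * cLp')))) * (P.𝔔ℓ ^ 5 * Real.exp (1 * (P.𝔘ℓ / (2 * cLp')))) :=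
        mul_le_mul hD hQ (abs_nonneg _) (by positivity)
    _ = P.AmaxPMℓ := by
        unfold PadicW80ParL.AmaxPMℓ PadicW80ParL.Efacℓ
        rw [show (2 : ℝ) * (P.𝔘ℓ / (2 * cLp')) = 1 * (P.𝔘ℓ / (2 * cLp')) + 1 * (P.𝔘ℓ / (2 * cLp')) by ring,
          Real.exp_add]; ring

/-- **`|rHalf| ≤ RHalfPM = 𝔔⁵ E(2)`** on the box of level `J < J₀ᵖ`, `|τ| ≤ T`, `s < 2^{J+1} S₀ᵖ`
(`|qΔ| ≤ 𝔔⁴`, `|qA| ≤ 𝔔`, `|qEh| ≤ E(2)`). [cite: Waldschmidt1980, §3.4 (3.22) (p. 270)] -/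
theorem SizeHyp.abs_rHalf_le_pm {J : ℕ} (hJ : J < P.J₀ℓ) {u : Idx S.d P.hparℓ P.Lbℓ}
    (hu : u ∈ S.box (h := P.hparℓ) (Lb := P.Lbℓ) P.Lℓ P.Lθℓ J) {τ : Tau S.d} (hτ : tauNorm τ ≤ P.Tℓ)
    {s : ℕ} (hs : s < 2 ^ (J + 1) * P.S₀ℓ) :
    |(S.rHalf (h := P.hparℓ) P.J₀ℓ J u τ s : ℝ)| ≤ P.RHalfPMℓ := by
  have hτ1 : τ.1 ≤ P.Tℓ := by unfold tauNorm at hτ; omega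
  have hτ2 : ∑ j, τ.2 j ≤ P.Tℓ := by unfold tauNorm at hτ; omega
  have hs' : s ≤ 2 ^ (S.d + 1 + (J + 1)) * P.S₀ℓ := by
    have : 2 ^ (J + 1) * P.S₀ℓ ≤ 2 ^ (S.d + 1 + (J + 1)) * P.S₀ℓ :=
      Nat.mul_le_mul_right _ (Nat.pow_le_pow_right two_pos (by omega))
    omega
  have hs2 : s ≤ 2 ^ J * (2 * P.S₀ℓ) := by rw [← Nat.mul_assoc, ← pow_succ]; exact hs.le
  have h𝔔 := P.𝔔_pos
  unfold rHalf; push_cast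
  rw [abs_mul, abs_mul]
  have h1 : |(S.qΔ (h := P.hparℓ) P.J₀ℓ (J + 1) u τ.1 s : ℝ)| ≤ P.𝔔ℓ ^ 4 := S.abs_qΔ_le_𝔔 P hJ u hs' hτ1
  have h2 : |(S.qA u τ.2 : ℝ)| ≤ P.𝔔ℓ ^ 1 := by rw [pow_one]; exact hy.abs_qA_le_𝔔 hu hτ2
  have h3 : |(S.qEh u s : ℝ)| ≤ Real.exp ((2 : ℕ) * (P.𝔘ℓ / (2 * cLp'))) := hy.abs_qEh_le_pℓ hu hs2
  rw [Nat.cast_ofNat] at h3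
  have h12 := P.mul_le_𝔔_pow h1 h2 (abs_nonneg _)
  unfold PadicW80ParL.RHalfPMℓ PadicW80ParL.Efacℓ
  exact mul_le_mul h12 h3 (abs_nonneg _) (by positivity)

/-- **`Dhalf ≤ DmaxHPM = 𝔔¹⁶ E(2)`** for `J < J₀ᵖ`, `|τ| ≤ T`, `s < 2^{J+1} S₀ᵖ`
(`ν^{τ₀} ≤ 𝔔¹⁵`, `|b_θ|^{∑τ'} ≤ 𝔔`, denominators `≤ E(2)`). [cite: Waldschmidt1980, §3.4 (3.22) (p. 270)] -/
theorem SizeHyp.Dhalf_le_pm {J : ℕ} (hJ : J < P.J₀ℓ) {τ : Tau S.d} (hτ : tauNorm τ ≤ P.Tℓ)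
    {s : ℕ} (hs : s < 2 ^ (J + 1) * P.S₀ℓ) :
    ((S.Dhalf (h := P.hparℓ) P.J₀ℓ J P.Lℓ P.Lθℓ s τ : ℕ) : ℝ) ≤ P.DmaxHPMℓ := by
  have hτ1 : τ.1 ≤ P.Tℓ := by unfold tauNorm at hτ; omega
  have hτ2 : ∑ j, τ.2 j ≤ P.Tℓ := by unfold tauNorm at hτ; omega
  have hs' : s ≤ 2 ^ (S.d + 1 + (J + 1)) * P.S₀ℓ := by
    have : 2 ^ (J + 1) * P.S₀ℓ ≤ 2 ^ (S.d + 1 + (J + 1)) * P.S₀ℓ :=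
      Nat.mul_le_mul_right _ (Nat.pow_le_pow_right two_pos (by omega))
    omega
  have hx : ((scale P.J₀ℓ (J + 1) * s : ℕ) : ℝ) ≤ P.Xptℓ := S.scale_mul_le_Xptℓ P hJ hs'
  have h𝔔 := P.𝔔_pos
  unfold Dhalf
  rw [Nat.cast_mul, Nat.cast_mul]
  have h1 : ((nuBound (scale P.J₀ℓ (J + 1) * s) P.hparℓ ^ τ.1 : ℕ) : ℝ) ≤ P.𝔔ℓ ^ 15 := by
    rw [Nat.cast_pow]; exact P.nuBound_pow_le_𝔔 hx hτ1
  have h2 : ((S.bθ.natAbs ^ (∑ j, τ.2 j) : ℕ) : ℝ) ≤ P.𝔔ℓ ^ 1 := by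
    rw [pow_one]; exact hy.natAbs_bθ_pow_le_𝔔 hτ2
  have hdiv : ∀ Lq : ℕ, Lq / 2 ^ J * s ≤ 2 * Lq * P.S₀ℓ := by
    intro Lq
    calc Lq / 2 ^ J * s ≤ (Lq / 2 ^ J) * (2 ^ (J + 1) * P.S₀ℓ) := Nat.mul_le_mul_left _ hs.le
      _ = 2 * ((Lq / 2 ^ J) * 2 ^ J) * P.S₀ℓ := by rw [pow_succ]; ring
      _ ≤ 2 * Lq * P.S₀ℓ := by
          have := Nat.div_mul_le_self Lq (2 ^ J)
          exact Nat.mul_le_mul_right _ (Nat.mul_le_mul_left _ this)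
  have h3 : (((∏ j, (S.α j).den ^ (P.Lℓ j / 2 ^ J * s)) * S.θ.den ^ (P.Lθℓ / 2 ^ J * s) : ℕ) : ℝ) ≤
      Real.exp (2 * (P.𝔘ℓ / (2 * cLp'))) := by
    have := hy.den_prod_le_pℓ (c := 2) (fun j => hdiv (P.Lℓ j)) (hdiv P.Lθℓ)
    push_cast at this ⊢
    exact this
  have h12 := P.mul_le_𝔔_pow h1 h2 (Nat.cast_nonneg _)
  unfold PadicW80ParL.DmaxHPMℓ PadicW80ParL.Efacℓ
  exact mul_le_mul h12 h3 (Nat.cast_nonneg _) (by positivity)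

end Setup

end Literature.NumberTheory.Transcendental.CW77

end
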